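import Summits.KontsevichZagierPeriods.KontsevichZagierPeriods.Theorems.SoloBlindLemniscateSector
import HarnessLib

/-!
# The lemniscatic modulus: `K(1/√2)`, `E(1/√2)` and Legendre's relation inside the rules

Three `ℚ`-rational one-dimensional representations in Legendre's normal form at the modulus
`k² = ½` (written with integer coefficients),

* `G_K = [(0,1), 1/√((1-x²)(2-x²))]` (`legK1`, value `K(1/√2)/√2`),
* `G_B = [(0,1), √((1-x²)/(2-x²))]` (`legB1`),
* `G_E = [(0,1), √((2-x²)/(1-x²))]` (`legE1`, value `√2·E(1/√2)`),

and the algebraic change of variables `x = √(1-t²)` (a move of type (2)) which turns them into the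
lemniscatic integrands: `G_K ≡ A₁ = [(0,1), dt/√(1-t⁴)]`, `G_B ≡ B₁ = [(0,1), t²dt/√(1-t⁴)]`
(`lemnA1_sub_legK1`, `lemnB1_sub_legB1`), while `G_E ≡ G_K + G_B` is integrand additivity
(`legE1_sub`).  Consequences, all unconditional:

* `[G_K] = [A₂]`, `[G_B] = [B₂]`, `[G_E] = [A₂] + [B₂]` in `Q`; the three lie in the lemniscate
  sector;
* **Legendre's relation at `k = 1/√2` is Euler's relation**: `[G_K]·[G_B] = α(1)`
  (`legendre_euler`),
  i.e. `G_K × G_B ≡ [(0,1), 1/(1+x²)]` by finitely many moves (`kz_legendre_relation`); numerically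
  `2EK - K² = π/2` (`legK1_value_mul_legB1_value : ∫∫ = π/4`);
* `G_K ≡ A₂` (`kz_legK1_lemnA2`): a one-dimensional and a two-dimensional rational representation
  of `ϖ/2 = Γ(¼)²/(4√(2π))`, KZ-equivalent.

References: A.-M. Legendre, *Exercices de calcul intégral* I (1811); Kontsevich–Zagier, *Periods*
(2001), §1.1.
-/

noncomputable section

namespace Summit.KontsevichZagierPeriods.KontsevichZagierPeriods.Theorems

open Set MeasureTheory
open Literature.ModelTheory.ExponentialFields (IsSemialgebraic)
open MvPolynomial (aeval X C)
open Literature.NumberTheory.Transcendental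
open Literature.NumberTheory.Transcendental.KZ
open Literature.Analysis.SpecialFunctions.Selberg
  (integrableOn_Ioo_rpow_mul_one_sub_rpow_and_integral_eq)

namespace SoloBlind

section estimates

variable {x : ℝ}

/-- Elementary facts on `(0,1)` used by the chart `x = √(1-t²)`, bundled:
`0 < 1 - x²`, `0 < 2 - x²`, `√(1-x²) ∈ (0,1)`, `(√(1-x²))² = 1 - x²` and
`√(1-x⁴) = √(1-x²)·√(1+x²)`. -/
theorem sqrtChart_aux (hx : x ∈ Ioo (0:ℝ) 1) :
    0 < 1 - x ^ 2 ∧ 0 < 2 - x ^ 2 ∧ Real.sqrt (1 - x ^ 2) ∈ Ioo (0:ℝ) 1 ∧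
      Real.sqrt (1 - x ^ 2) ^ 2 = 1 - x ^ 2 ∧
      Real.sqrt (1 - x ^ 4) = Real.sqrt (1 - x ^ 2) * Real.sqrt (1 + x ^ 2) := by
  have h1 : 0 < 1 - x ^ 2 := by nlinarith [hx.1, hx.2]
  refine ⟨h1, by nlinarith [hx.1, hx.2], ⟨Real.sqrt_pos.mpr h1, ?_⟩, Real.sq_sqrt h1.le, ?_⟩
  · rw [Real.sqrt_lt' one_pos]
    nlinarith [hx.1]
  · rw [← Real.sqrt_mul h1.le]
    congr 1
    ring

end estimates

/-! ## The three integrands -/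

/-- `g_K(x) = 1/√((1-x²)(2-x²))`. -/
def legK (x : ℝ) : ℝ := 1 / Real.sqrt ((1 - x ^ 2) * (2 - x ^ 2))

/-- `g_B(x) = √((1-x²)/(2-x²))`. -/
def legB (x : ℝ) : ℝ := Real.sqrt ((1 - x ^ 2) / (2 - x ^ 2))

/-- `g_E(x) = √((2-x²)/(1-x²))`. -/
def legE (x : ℝ) : ℝ := Real.sqrt ((2 - x ^ 2) / (1 - x ^ 2))

/-- `g_E = g_K + g_B` on `(0,1)` (`(2-x²) = 1 + (1-x²)` over `√((1-x²)(2-x²))`). -/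
theorem legE_eq_add {x : ℝ} (hx : x ∈ Ioo (0:ℝ) 1) : legE x = legK x + legB x := by
  have h1 := (sqrtChart_aux hx).1
  have h2 := (sqrtChart_aux hx).2.1
  have hs1 := Real.sqrt_pos.mpr h1
  have hs2 := Real.sqrt_pos.mpr h2
  rw [legE, legK, legB, Real.sqrt_div' _ h1.le, Real.sqrt_div' _ h2.le, Real.sqrt_mul h1.le]
  rw [div_add_div _ _ (mul_pos hs1 hs2).ne' hs2.ne', div_eq_div_iff hs1.ne' (by positivity)]
  have e1 : Real.sqrt (1 - x ^ 2) * Real.sqrt (1 - x ^ 2) = 1 - x ^ 2 := Real.mul_self_sqrt h1.le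
  have e2 : Real.sqrt (2 - x ^ 2) * Real.sqrt (2 - x ^ 2) = 2 - x ^ 2 := Real.mul_self_sqrt h2.le
  linear_combination (Real.sqrt (1 - x ^ 2) * Real.sqrt (2 - x ^ 2)) * e2 -
    (Real.sqrt (1 - x ^ 2) * Real.sqrt (2 - x ^ 2)) * e1

/-- The Mellin form of `g_K`: `(1-x²)^{-1/2}(2-x²)^{-1/2}`. -/
theorem legK_eq_rpow {x : ℝ} (hx : x ∈ Ioo (0:ℝ) 1) : legK x =
    (1 - x ^ 2) ^ (((-1 / 2 : ℚ) : ℚ) : ℝ) * (2 - x ^ 2) ^ (((-1 / 2 : ℚ) : ℚ) : ℝ) := by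
  have h1 := (sqrtChart_aux hx).1
  have h2 := (sqrtChart_aux hx).2.1
  rw [legK, show (((-1 / 2 : ℚ) : ℚ) : ℝ) = -((1:ℝ) / 2) by push_cast; ring, Real.rpow_neg h1.le,
    Real.rpow_neg h2.le, ← Real.sqrt_eq_rpow, ← Real.sqrt_eq_rpow, Real.sqrt_mul h1.le, ← mul_inv,
    inv_eq_one_div]

/-- The Mellin form of `g_B`: `(1-x²)^{1/2}(2-x²)^{-1/2}`. -/
theorem legB_eq_rpow {x : ℝ} (hx : x ∈ Ioo (0:ℝ) 1) : legB x =
    (1 - x ^ 2) ^ (((1 / 2 : ℚ) : ℚ) : ℝ) * (2 - x ^ 2) ^ (((-1 / 2 : ℚ) : ℚ) : ℝ) := by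
  have h1 := (sqrtChart_aux hx).1
  have h2 := (sqrtChart_aux hx).2.1
  rw [legB, show (((-1 / 2 : ℚ) : ℚ) : ℝ) = -((1:ℝ) / 2) by push_cast; ring,
    show (((1 / 2 : ℚ) : ℚ) : ℝ) = (1:ℝ) / 2 by push_cast; ring, Real.rpow_neg h2.le,
    ← Real.sqrt_eq_rpow, ← Real.sqrt_eq_rpow, Real.sqrt_div' _ h2.le, div_eq_mul_inv]

/-- The Mellin form of `g_E`: `(1-x²)^{-1/2}(2-x²)^{1/2}`. -/
theorem legE_eq_rpow {x : ℝ} (hx : x ∈ Ioo (0:ℝ) 1) : legE x =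
    (1 - x ^ 2) ^ (((-1 / 2 : ℚ) : ℚ) : ℝ) * (2 - x ^ 2) ^ (((1 / 2 : ℚ) : ℚ) : ℝ) := by
  have h1 := (sqrtChart_aux hx).1
  have h2 := (sqrtChart_aux hx).2.1
  rw [legE, show (((-1 / 2 : ℚ) : ℚ) : ℝ) = -((1:ℝ) / 2) by push_cast; ring,
    show (((1 / 2 : ℚ) : ℚ) : ℝ) = (1:ℝ) / 2 by push_cast; ring, Real.rpow_neg h1.le,
    ← Real.sqrt_eq_rpow, ← Real.sqrt_eq_rpow, Real.sqrt_div' _ h1.le, div_eq_inv_mul]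

/-- A two-factor Mellin integrand on `(0,1)` (polynomials `1-X²`, `2-X²`) is semialgebraic. -/
theorem isSemialgebraicFunOn_leg (e₁ e₂ : ℚ) {g : ℝ → ℝ}
    (hg : ∀ x ∈ Ioo (0:ℝ) 1, g x = (1 - x ^ 2) ^ ((e₁ : ℚ) : ℝ) * (2 - x ^ 2) ^ ((e₂ : ℚ) : ℝ)) :
    IsSemialgebraicFunOn ℚ (line (Ioo 0 1)) (fun x : Fin 1 → ℝ => g (x 0)) := by
  have h := isSemialgebraicFunOn_mellinIntegrand
    (isSemialgebraic_line_Ioo isAlgebraic_zero isAlgebraic_one)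
    ![(1 - X 0 ^ 2 : MvPolynomial (Fin 1) ℚ), 2 - X 0 ^ 2] ![e₁, e₂] 1 (fun x hx k => by
      have hx : x 0 ∈ Ioo (0:ℝ) 1 := hx
      fin_cases k
      · simpa using (sqrtChart_aux hx).1
      · simpa using (sqrtChart_aux hx).2.1)
  refine h.congr fun x hx => ?_
  have hx : x 0 ∈ Ioo (0:ℝ) 1 := hx
  simp only [mellinIntegrand_apply, Fin.prod_univ_two, Matrix.cons_val_zero, Matrix.cons_val_one,
    Matrix.cons_val_fin_one, map_sub, map_one, map_pow, MvPolynomial.aeval_X, map_ofNat, hg _ hx]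
  push_cast
  ring

/-- `g_K` is `ℚ`-semialgebraic on `(0,1)`. -/
theorem isSemialgebraicFunOn_legK :
    IsSemialgebraicFunOn ℚ (line (Ioo 0 1)) (fun x : Fin 1 → ℝ => legK (x 0)) :=
  isSemialgebraicFunOn_leg (-1 / 2) (-1 / 2) fun _ hx => legK_eq_rpow hx

/-- `g_B` is `ℚ`-semialgebraic on `(0,1)`. -/
theorem isSemialgebraicFunOn_legB :
    IsSemialgebraicFunOn ℚ (line (Ioo 0 1)) (fun x : Fin 1 → ℝ => legB (x 0)) :=
  isSemialgebraicFunOn_leg (1 / 2) (-1 / 2) fun _ hx => legB_eq_rpow hx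

/-- `g_E` is `ℚ`-semialgebraic on `(0,1)`. -/
theorem isSemialgebraicFunOn_legE :
    IsSemialgebraicFunOn ℚ (line (Ioo 0 1)) (fun x : Fin 1 → ℝ => legE (x 0)) :=
  isSemialgebraicFunOn_leg (-1 / 2) (1 / 2) fun _ hx => legE_eq_rpow hx

/-- Domination: `g_K ≤ 1/√(1-x)` on `(0,1)` (since `(1-x²)(2-x²) ≥ 1-x`). -/
theorem legK_le {x : ℝ} (hx : x ∈ Ioo (0:ℝ) 1) : legK x ≤ 1 / Real.sqrt (1 - x) := by
  have h1 : 0 < 1 - x := sub_pos.mpr hx.2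
  refine one_div_le_one_div_of_le (Real.sqrt_pos.mpr h1) (Real.sqrt_le_sqrt ?_)
  nlinarith [hx.1, hx.2, (sqrtChart_aux hx).1, mul_pos hx.1 h1]

/-- `g_K > 0` on `(0,1)`. -/
theorem legK_pos {x : ℝ} (hx : x ∈ Ioo (0:ℝ) 1) : 0 < legK x :=
  one_div_pos.mpr (Real.sqrt_pos.mpr (mul_pos ((sqrtChart_aux hx).1) ((sqrtChart_aux hx).2.1)))

/-- `g_K` is continuous on `(0,1)`. -/
theorem continuousOn_legK : ContinuousOn legK (Ioo 0 1) :=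
  continuousOn_const.div (by fun_prop : Continuous fun x : ℝ =>
      Real.sqrt ((1 - x ^ 2) * (2 - x ^ 2))).continuousOn fun _ hx =>
    (Real.sqrt_pos.mpr (mul_pos ((sqrtChart_aux hx).1) ((sqrtChart_aux hx).2.1))).ne'

/-- `g_K` is integrable on `(0,1)` (dominated by the Beta integrand `(1-x)^{-1/2}`). -/
theorem integrableOn_legK : IntegrableOn legK (Ioo 0 1) := by
  have hg := (integrableOn_Ioo_rpow_mul_one_sub_rpow_and_integral_eq (a := 1) (b := 1 / 2)
    one_pos (by norm_num)).1
  refine Integrable.mono' hg (continuousOn_legK.aestronglyMeasurable measurableSet_Ioo) ?_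
  refine (ae_restrict_iff' measurableSet_Ioo).mpr (Filter.Eventually.of_forall fun x hx => ?_)
  rw [Real.norm_eq_abs, abs_of_pos (legK_pos hx), ← one_div_sqrt_eq_betaIntegrand hx]
  exact legK_le hx

/-- `0 ≤ g_B`. -/
theorem legB_nonneg (x : ℝ) : 0 ≤ legB x := Real.sqrt_nonneg _

/-- `g_B ≤ 1` on `(0,1)`. -/
theorem legB_le_one {x : ℝ} (hx : x ∈ Ioo (0:ℝ) 1) : legB x ≤ 1 := by
  rw [legB, Real.sqrt_le_one, div_le_one ((sqrtChart_aux hx).2.1)]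
  linarith

/-- `g_B` is continuous on `[0,1]`. -/
theorem continuousOn_legB : ContinuousOn legB (Icc 0 1) :=
  ((by fun_prop : Continuous fun x : ℝ => 1 - x ^ 2).continuousOn.div
    (by fun_prop : Continuous fun x : ℝ => 2 - x ^ 2).continuousOn fun x hx => by
      have : x ^ 2 ≤ 1 := pow_le_one₀ hx.1 hx.2
      nlinarith).sqrt

/-- `g_B` is integrable on `(0,1)`. -/
theorem integrableOn_legB : IntegrableOn legB (Ioo 0 1) :=
  (continuousOn_legB.integrableOn_Icc (μ := volume)).mono_set Ioo_subset_Icc_self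

/-- `g_E` is integrable on `(0,1)` (it is `g_K + g_B` there). -/
theorem integrableOn_legE : IntegrableOn legE (Ioo 0 1) :=
  (integrableOn_legK.add integrableOn_legB).congr_fun (fun _ hx => (legE_eq_add hx).symm)
    measurableSet_Ioo

/-! ## The three rational representations -/

/-- **`G_K = [(0,1), 1/√((1-x²)(2-x²))]`** (value `K(1/√2)/√2 = ϖ/2`). -/
def legK1 : IntegralRep 1 :=
  lineRep (Ioo 0 1) legK (isSemialgebraic_line_Ioo isAlgebraic_zero isAlgebraic_one)
    isSemialgebraicFunOn_legK integrableOn_legK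

/-- **`G_B = [(0,1), √((1-x²)/(2-x²))]`** (value `√2·E(1/√2) - K(1/√2)/√2`). -/
def legB1 : IntegralRep 1 :=
  lineRep (Ioo 0 1) legB (isSemialgebraic_line_Ioo isAlgebraic_zero isAlgebraic_one)
    isSemialgebraicFunOn_legB integrableOn_legB

/-- **`G_E = [(0,1), √((2-x²)/(1-x²))]`** (value `√2·E(1/√2)`). -/
def legE1 : IntegralRep 1 :=
  lineRep (Ioo 0 1) legE (isSemialgebraic_line_Ioo isAlgebraic_zero isAlgebraic_one)
    isSemialgebraicFunOn_legE integrableOn_legE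

/-! ## The chart `x = √(1-t²)` -/

/-- `t ↦ √(1-t²)` is `ℚ`-semialgebraic on `(0,1)`. -/
theorem isSemialgebraicFunOn_sqrtChart :
    IsSemialgebraicFunOn ℚ (line (Ioo 0 1)) (fun x : Fin 1 → ℝ => Real.sqrt (1 - x 0 ^ 2)) := by
  refine isSemialgebraicFunOn_leg (1 / 2) 0 (g := fun t => Real.sqrt (1 - t ^ 2)) fun x hx => ?_
  rw [Real.sqrt_eq_rpow, Rat.cast_zero, Real.rpow_zero, mul_one]
  norm_num

/-- The derivative of the chart: `d√(1-t²)/dt = -2t/(2√(1-t²))`. -/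
theorem hasDerivWithinAt_sqrtChart {t : ℝ} (ht : t ∈ Ioo (0:ℝ) 1) :
    HasDerivWithinAt (fun t : ℝ => Real.sqrt (1 - t ^ 2))
      (-(2 * t) / (2 * Real.sqrt (1 - t ^ 2))) (Ioo 0 1) t := by
  have h1 : HasDerivAt (fun t : ℝ => 1 - t ^ 2) (-(2 * t)) t := by
    simpa using (hasDerivAt_pow 2 t).const_sub 1
  exact (h1.sqrt ((sqrtChart_aux ht).1).ne').hasDerivWithinAt

/-- The chart maps `(0,1)` onto `(0,1)` (it is an involution there). -/
theorem image_sqrtChart : Ioo (0:ℝ) 1 = (fun t : ℝ => Real.sqrt (1 - t ^ 2)) '' Ioo 0 1 := by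
  ext u
  constructor
  · intro hu
    refine ⟨Real.sqrt (1 - u ^ 2), (sqrtChart_aux hu).2.2.1, ?_⟩
    show Real.sqrt (1 - Real.sqrt (1 - u ^ 2) ^ 2) = u
    rw [(sqrtChart_aux hu).2.2.2.1, sub_sub_cancel, Real.sqrt_sq hu.1.le]
  · rintro ⟨t, ht, rfl⟩
    exact (sqrtChart_aux ht).2.2.1

/-- `|chart'(t)| = t/√(1-t²)`. -/
theorem abs_sqrtChart_deriv {t : ℝ} (ht : t ∈ Ioo (0:ℝ) 1) :
    |-(2 * t) / (2 * Real.sqrt (1 - t ^ 2))| = t / Real.sqrt (1 - t ^ 2) := by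
  rw [abs_div, abs_neg, abs_of_pos (by linarith [ht.1] : (0:ℝ) < 2 * t),
    abs_of_pos (mul_pos two_pos (Real.sqrt_pos.mpr ((sqrtChart_aux ht).1))),
    mul_div_mul_left _ _ two_ne_zero]

/-- Pull-back of `g_K`: `g_K(√(1-t²))·t/√(1-t²) = 1/√(1-t⁴)`. -/
theorem legK_pullback {t : ℝ} (ht : t ∈ Ioo (0:ℝ) 1) :
    1 / Real.sqrt (1 - t ^ 4) =
      legK (Real.sqrt (1 - t ^ 2)) * |-(2 * t) / (2 * Real.sqrt (1 - t ^ 2))| := by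
  have hs1 := Real.sqrt_pos.mpr ((sqrtChart_aux ht).1)
  have hs3 : 0 < Real.sqrt (1 + t ^ 2) := Real.sqrt_pos.mpr (by positivity)
  have ht0 : t ≠ 0 := ht.1.ne'
  rw [abs_sqrtChart_deriv ht, legK, (sqrtChart_aux ht).2.2.2.1, sub_sub_cancel,
    show (2:ℝ) - (1 - t ^ 2) = 1 + t ^ 2 by ring, Real.sqrt_mul (sq_nonneg t),
    Real.sqrt_sq ht.1.le, (sqrtChart_aux ht).2.2.2.2]
  field_simp

/-- Pull-back of `g_B`: `g_B(√(1-t²))·t/√(1-t²) = t²/√(1-t⁴)`. -/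
theorem legB_pullback {t : ℝ} (ht : t ∈ Ioo (0:ℝ) 1) :
    t ^ 2 / Real.sqrt (1 - t ^ 4) =
      legB (Real.sqrt (1 - t ^ 2)) * |-(2 * t) / (2 * Real.sqrt (1 - t ^ 2))| := by
  have hs1 := Real.sqrt_pos.mpr ((sqrtChart_aux ht).1)
  have h3 : (0:ℝ) < 1 + t ^ 2 := by positivity
  have hs3 : 0 < Real.sqrt (1 + t ^ 2) := Real.sqrt_pos.mpr h3
  rw [abs_sqrtChart_deriv ht, legB, (sqrtChart_aux ht).2.2.2.1, sub_sub_cancel,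
    show (2:ℝ) - (1 - t ^ 2) = 1 + t ^ 2 by ring, Real.sqrt_div' _ h3.le,
    Real.sqrt_sq ht.1.le, (sqrtChart_aux ht).2.2.2.2]
  field_simp

/-- **Move (`x = √(1-t²)`): `A₁ ≡ G_K`.** -/
theorem lemnA1_sub_legK1 : of lemnA1 - of legK1 ∈ relations := by
  unfold lemnA1 legK1
  have hinj : InjOn (fun t : ℝ => Real.sqrt (1 - t ^ 2)) (Ioo 0 1) := by
    intro s hs t ht h
    have h' : 1 - s ^ 2 = 1 - t ^ 2 :=
      (Real.sqrt_inj ((sqrtChart_aux hs).1).le ((sqrtChart_aux ht).1).le).mp h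
    exact (pow_left_inj₀ hs.1.le ht.1.le two_ne_zero).mp (by linarith)
  exact lineRep_subst (fun t => Real.sqrt (1 - t ^ 2))
    (fun t => -(2 * t) / (2 * Real.sqrt (1 - t ^ 2))) isSemialgebraicFunOn_sqrtChart
    (fun t ht => hasDerivWithinAt_sqrtChart ht) hinj image_sqrtChart
    (fun t ht => legK_pullback ht)

/-- **Move (`x = √(1-t²)`): `B₁ ≡ G_B`.** -/
theorem lemnB1_sub_legB1 : of lemnB1 - of legB1 ∈ relations := by
  unfold lemnB1 legB1
  have hinj : InjOn (fun t : ℝ => Real.sqrt (1 - t ^ 2)) (Ioo 0 1) := by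
    intro s hs t ht h
    have h' : 1 - s ^ 2 = 1 - t ^ 2 :=
      (Real.sqrt_inj ((sqrtChart_aux hs).1).le ((sqrtChart_aux ht).1).le).mp h
    exact (pow_left_inj₀ hs.1.le ht.1.le two_ne_zero).mp (by linarith)
  exact lineRep_subst (fun t => Real.sqrt (1 - t ^ 2))
    (fun t => -(2 * t) / (2 * Real.sqrt (1 - t ^ 2))) isSemialgebraicFunOn_sqrtChart
    (fun t ht => hasDerivWithinAt_sqrtChart ht) hinj image_sqrtChart
    (fun t ht => legB_pullback ht)

/-- **Move (integrand additivity): `G_E ≡ G_K + G_B`.** -/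
theorem legE1_sub : of legE1 - of legK1 - of legB1 ∈ relations := by
  -- domain equalities via `lineRep_domain` rewrites (a bare `rfl` sends the kernel unfolding reals)
  refine integrandAddRel_subset_relations ⟨1, legE1, legK1, legB1,
    by simp only [legE1, legK1, lineRep_domain], by simp only [legE1, legB1, lineRep_domain],
    fun x hx => ?_, rfl⟩
  have hx' : x 0 ∈ Ioo (0:ℝ) 1 := by rw [legE1, lineRep_domain] at hx; exact hx
  simp only [legE1, legK1, legB1, lineRep_integrand, Pi.add_apply]
  exact legE_eq_add hx'

/-! ## Classes in `Q` and consequences -/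

/-- `[G_K] = [A₂]`. -/
theorem mkQ_legK1 : mkQ (of legK1) = mkQ (of lemnA2) := by
  rw [mkQ_eq_mkQ_iff, ← sub_sub_sub_cancel_right _ _ (of lemnA1)]
  exact relations.sub_mem (by simpa using relations.neg_mem lemnA1_sub_legK1) lemnA2_sub_lemnA1

/-- `[G_B] = [B₂]`. -/
theorem mkQ_legB1 : mkQ (of legB1) = mkQ (of lemnB2) := by
  rw [mkQ_eq_mkQ_iff, ← sub_sub_sub_cancel_right _ _ (of lemnB1)]
  exact relations.sub_mem (by simpa using relations.neg_mem lemnB1_sub_legB1) lemnB2_sub_lemnB1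

/-- `[G_E] = [A₂] + [B₂]`. -/
theorem mkQ_legE1 : mkQ (of legE1) = mkQ (of lemnA2) + mkQ (of lemnB2) := by
  rw [← mkQ_legK1, ← mkQ_legB1, ← map_add, mkQ_eq_mkQ_iff, ← sub_sub]
  exact legE1_sub

/-- `[G_K] = ¼β(¼,½)`, `[G_B] = ¼β(¾,½)`. -/
theorem mkQ_legK1_eq_betaQ : mkQ (of legK1) = (((1:ℚ) / 4 : ℚ) : K₀) • betaQ (1 / 4) (1 / 2) ∧
    mkQ (of legB1) = (((1:ℚ) / 4 : ℚ) : K₀) • betaQ (3 / 4) (1 / 2) := by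
  rw [mkQ_legK1, mkQ_legB1, mkQ_lemnA2, mkQ_lemnB2]
  exact ⟨rfl, rfl⟩

/-- `G_K`, `G_B`, `G_E` lie in the lemniscate sector. -/
theorem of_leg_mem_lemniscateSector : of legK1 ∈ lemniscateSector ∧ of legB1 ∈ lemniscateSector ∧
    of legE1 ∈ lemniscateSector := by
  refine ⟨?_, ?_, ?_⟩
  · rw [mem_lemniscateSector, mkQ_legK1]; exact of_lemnA2_mem_lemniscateSector
  · rw [mem_lemniscateSector, mkQ_legB1]; exact of_lemnB2_mem_lemniscateSector
  · rw [mem_lemniscateSector, mkQ_legE1]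
    exact add_mem of_lemnA2_mem_lemniscateSector of_lemnB2_mem_lemniscateSector

/-- **`G_K ≡ A₂`**: the rational one-dimensional representation `∫₀¹ dx/√((1-x²)(2-x²))` and the
rational two-dimensional representation `A₂` (area under `1/√(1-x⁴)`) of `ϖ/2` are KZ-equivalent. -/
theorem kz_legK1_lemnA2 : Equivalent legK1 lemnA2 := by
  rw [Equivalent, ← mkQ_eq_mkQ_iff, mkQ_legK1]

/-- **Legendre's relation at the lemniscatic modulus is Euler's relation**:
`[G_K]·[G_B] = α(1)` in `Q`. -/
theorem legendre_euler : mkQ (of legK1) * mkQ (of legB1) = alpha 1 := by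
  rw [mkQ_legK1, mkQ_legB1, lemniscate_euler]

/-- **`G_K × G_B ≡ [(0,1), 1/(1+x²)]`** (`2E(k)K(k) - K(k)² = π/2` at `k = 1/√2`, inside the
rules). -/
theorem kz_legendre_relation :
    Equivalent (legK1.prod legB1) (atanCell 1 1 isAlgebraic_one isAlgebraic_one) := by
  rw [Equivalent, ← mkQ_eq_mkQ_iff, ← of_mul_of, mkQ_mul, legendre_euler, alpha_eq isAlgebraic_one]

/-- `G_K × G_B ≡ A₂ × B₂`. -/
theorem kz_legendre_lemniscate : Equivalent (legK1.prod legB1) (lemnA2.prod lemnB2) := by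
  rw [Equivalent, ← mkQ_eq_mkQ_iff, ← of_mul_of, ← of_mul_of, mkQ_mul, mkQ_mul, mkQ_legK1,
    mkQ_legB1]

/-- `∫₀¹ dx/√((1-x²)(2-x²)) = a = ϖ/2 = Γ(¼)²/(4√(2π))`. -/
theorem legK1_value : legK1.value = Real.Gamma (1 / 4) ^ 2 / (4 * Real.sqrt (2 * Real.pi)) := by
  have h := congrArg evalQ mkQ_legK1
  rw [evalQ_mkQ, evalQ_mkQ, eval_of, eval_of] at h
  rw [h, lemnA2_value]

/-- `∫₀¹ √((1-x²)/(2-x²)) dx = b = π/(4a)`. -/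
theorem legB1_value : legB1.value = lemnB2.value := by
  have h := congrArg evalQ mkQ_legB1
  rwa [evalQ_mkQ, evalQ_mkQ, eval_of, eval_of] at h

/-- `∫₀¹ √((2-x²)/(1-x²)) dx = a + b` (`= √2·E(1/√2)`). -/
theorem legE1_value : legE1.value = lemnA2.value + lemnB2.value := by
  have h := congrArg evalQ mkQ_legE1
  rwa [map_add, evalQ_mkQ, evalQ_mkQ, evalQ_mkQ, eval_of, eval_of, eval_of] at h

/-- **Legendre's relation, numerically**:
`∫₀¹ dx/√((1-x²)(2-x²)) · ∫₀¹ √((1-x²)/(2-x²)) dx = π/4`. -/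
theorem legK1_value_mul_legB1_value : legK1.value * legB1.value = Real.pi / 4 := by
  have h := congrArg evalQ legendre_euler
  rwa [map_mul, evalQ_mkQ, evalQ_mkQ, eval_of, eval_of, evalQ_alpha isAlgebraic_one zero_le_one,
    Real.arctan_one] at h

end SoloBlind

end Summit.KontsevichZagierPeriods.KontsevichZagierPeriods.Theorems
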